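import Literature.Probability.RandomPlanarGeometry.HexSAWBridgeDecay
import HarnessLib

/-!
# Crux `HexConjecture` (stmt-CriticalPhenomena-0808), line `root-locality-replaces-loewner`:
objects of the Krachun–Panagiotis renewal construction (definitions only)

Landing target:
`Summits/CriticalPhenomena/SAWScalingLimit/Theorems/SAWDevelopingMapHexConjectureKPDefs.lean`
(`--supports stmt-CriticalPhenomena-0808`; lead continuation prover-line-stmt-CriticalPhenomena-0808-c9-0).

The lever of the line after seat c8 is the WINDOW TWO-POINT LOWER BOUND (WTLB): the reference-window
floor-arch mass of the half-box dominates the Glazman–Manolescu triangle tail `triDl` LINEARLY.  Its cube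
version is Glazman–Manolescu's gluing (`HV.key_ineq`, in the tree); the linear version is, by
Krachun–Panagiotis (arXiv:2310.17299, §3), a consequence of their renewal construction (Lemma 3.1, the
constructions (a)/(b) of §3.2, Corollary 3.1) together with the lower regularity of the one sequence
`triDl`.  This file fixes, in the coordinate model `HV = ℤ × ℤ × Bool` of the honeycomb lattice
(`HexSAWLattice.lean` … `HexSAWBridgeDecay.lean`, whose conventions we keep: half-plane `{x₁ ≥ 0}`, root
mid-edge `a = {w, O}`, walks `HV.IsMidWalk`, weights `x_c^ℓ`), the OBJECTS of that construction, so that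
its lemmas can be registered as sub-goals of the crux item and proved in separate files:

* `slev v = x₀ + x₁ + b` — the "slanted level": the lines `slev = i ∣ i+1` are the lines
  `i + 1/2 + e^{2πi/3}ℝ` of [KP, §3.1], parallel to the right side of the triangle `T_L = HV.triV L`
  (`HV.IsRightDart L` crosses `slev : L → L+1`);
* `triV₂ K I` — the off-centred triangle `T_{K,I} = T_K ∩ {slev ≤ I}` of [KP, proof of Lemma 3.1] and
  its partition functions `triA₂`, `triDl₂`, `triDr₂`;
* `clipV i h = T_i ∩ {x₀ ≤ h}` — the trapezoid `Trap_{2i+1,x}` of [KP, §3.2] in the frame of the attached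
  triangle (the real axis becomes the cut `x₀ = h ∣ h+1`, a Duminil-Copin–Smirnov `ε̄`-cut), the cut
  class `IsClipDart h`, the four partition functions `clipA`, `clipDl`, `clipDr`, `clipE` (KP's
  `F^L, F^T, F^R, F^B`) and `triDminus i h` (KP's `D⁻_{2i+1,x}`: right-exiting triangle walks leaving
  the trapezoid);
* `crossCount i P`, `renewals k P` — the number of crossings of the line `slev = i ∣ i+1` by a walk
  list and the number `N(γ)` of renewal times of [KP, §3.1]; `rightWalks k` (the walks of `T_k` to its
  right side, `Σ = triDr k`), `htOf P` (the height `x₁` of the exit), `renBound k` (the explicit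
  bound `Σ_{i ≤ k} 2·triDl i · 2cos(π/8)·triDl ⌊(k-i-1)/2⌋` for `Σ_γ x_c^{ℓ(γ)} N(γ)`, [KP, Lemma 3.1]
  with `D_{2i+1} = 2·triDl i`, `B_m ≤ 2cos(π/8)·triDl ⌊(m-1)/2⌋`), `renCap k = 8·renBound k / triDr k`
  (KP's `M_k`);
* `attach x₀ x₁ = shift (x₀, x₁+1) ∘ rot60⁻¹` — the lattice automorphism placing the standard root dart
  `(w, O)` onto the right dart `((x₀,x₁,false), (x₀,x₁,true))`: the placement `x + e^{-πi/3}·` of the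
  attached triangle of [KP, §3.2] (and, iterated, of the third triangle of construction (b));
* `GoodHt T h`, `goodIdx T h` — KP's dichotomy (4)/(5): the exit height `h` is good when some
  `i ∈ [4T, 5T)` has `triDminus i h ≥ triDl i / 2` (`= D_{2i+1}/4`), and a chosen such `i`;
* `Dkp n = 2·triDl ⌊(n-1)/2⌋` — KP's sequence `D_n` (`D_{2k+1} = D_{2k+2} = D^Δ_{2k+1}`,
  `D_0 = 1/cos(π/8) = 2 x_c = 2·triDl 0`); `halfPlaneArch d` — KP's `G_d` (sup over the DCS trapezoids
  `S_{N+1,N+1}` of the coded floor-arch mass at offset `d`).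

Only definitions and their unfolding lemmas live here (reviewed definitions file of the line); the
identities, the renewal bound, the two constructions and the analytic lemma are separate files.
Sources: Krachun–Panagiotis 2023 (arXiv:2310.17299) §2.2, §3.1–3.2; Glazman–Manolescu 2020 §4.1;
Duminil-Copin–Smirnov 2012 §3.
-/

noncomputable section

open Finset
open Literature.Probability.RandomPlanarGeometry.SAW Literature.Probability.RandomPlanarGeometry.SAW.HV

namespace Summit.CriticalPhenomena.SAWScalingLimit.Theorems.HexConjecture.RootLocality

/-! ### The slanted level and the off-centred triangles `T_{K,I}` -/

/-- **The slanted level** `slev (x₀, x₁, b) = x₀ + x₁ + b`: constant along the lines parallel to the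
right side of `T_L`; an edge of `ℍ` changes it by `0` (the two oblique edges at a vertex) or by `±1`
(the edge `{(x₀,x₁,false), (x₀,x₁,true)}`).  The right side of `T_L` is `slev = L ∣ L+1`.
[cite: KrachunPanagiotis2026, §3.1 ("the line i + 1/2 + e^{2πi/3}ℝ")] -/
def slev (v : HV) : ℤ := v.1 + v.2.1 + bit v

/-- `slev` in coordinates. [folklore] -/
@[simp] theorem slev_mk (a b : ℤ) (c : Bool) : slev (a, b, c) = a + b + bit (a, b, c) := rfl

/-- `slev w = 0`. [folklore] -/
@[simp] theorem slev_wOut : slev wOut = 0 := by decide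

/-- `slev O = 0`. [folklore] -/
@[simp] theorem slev_hvOrigin : slev hvOrigin = 0 := by decide

/-- Along an edge the slanted level changes by `0` or `±1`. [cite: KrachunPanagiotis2026, §3.1] -/
theorem slev_sub_of_adj {u v : HV} (h : hvGraph.Adj u v) :
    slev v = slev u ∨ slev v = slev u + 1 ∨ slev v = slev u - 1 := by
  obtain ⟨a, b, c⟩ := u
  obtain ⟨a', b', c'⟩ := v
  cases c <;> cases c' <;> simp [hvGraph_adj, AdjRel, bit] at h ⊢ <;> omega

/-- **The off-centred triangle `T_{K,I}`** (vertex set): the cells of `T_K` with `slev ≤ I`, i.e.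
`{0 ≤ x₁, -K ≤ x₀, x₀ + x₁ + b ≤ I}` — for `I ≤ K` the equilateral lattice triangle with base
`[-K, I]` on the boundary line, containing the root `a` off-centre ("the triangle `T_{k,i}` defined as
the intersection of Tria_{2k+1} with the half-plane on the left side of the line `i + 1/2 + e^{2πi/3}ℝ`").
[cite: KrachunPanagiotis2026, proof of Lemma 3.1 (T_{k,i})] -/
def triV₂ (K I : ℕ) : Finset HV := (triV K).filter fun v => slev v ≤ I

/-- Membership in `T_{K,I}`. [cite: KrachunPanagiotis2026, proof of Lemma 3.1] -/
theorem mem_triV₂_iff {K I : ℕ} {v : HV} :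
    v ∈ triV₂ K I ↔ 0 ≤ v.2.1 ∧ -(K : ℤ) ≤ v.1 ∧ slev v ≤ I ∧ slev v ≤ K := by
  rw [triV₂, mem_filter, mem_triV_iff, slev]
  tauto

/-- `T_{K,I} ⊆ T_K`. [cite: KrachunPanagiotis2026, proof of Lemma 3.1] -/
theorem triV₂_subset (K I : ℕ) : triV₂ K I ⊆ triV K := filter_subset _ _

/-- For `I ≤ K`, the centred triangle `T_I` sits inside `T_{K,I}` (same right side, longer base to the
left): "there are more SAWs in `T_{k,i}` … than SAWs in Tria_{2i+1}". [cite: KrachunPanagiotis2026, proof of Lemma 3.1] -/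
theorem triV_subset_triV₂ {K I : ℕ} (h : I ≤ K) : triV I ⊆ triV₂ K I := by
  intro v hv
  rw [mem_triV_iff] at hv
  rw [mem_triV₂_iff, slev]
  omega

/-- `T_{K,K} = T_K`. [folklore] -/
theorem triV₂_self (K : ℕ) : triV₂ K K = triV K := by
  ext v
  rw [mem_triV₂_iff, mem_triV_iff, slev]
  tauto

/-- **`A` of `T_{K,I}`**: walks of `T_{K,I}` from `a` back to the base line (class `α`), at `x_c`.
[cite: KrachunPanagiotis2026, proof of Lemma 3.1] -/
def triA₂ (K I : ℕ) : ℝ :=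
  ∑ P ∈ (midWalks (triV₂ K I)).filter (fun P => IsAlphaDart (finalDart P)), hexCriticalFugacity ^ mwLen P

/-- **Left exits of `T_{K,I}`** (through the left side `x₀ = -K ∣ -K-1`). [cite: KrachunPanagiotis2026, proof of Lemma 3.1 (L_{k,i})] -/
def triDl₂ (K I : ℕ) : ℝ :=
  ∑ P ∈ (midWalks (triV₂ K I)).filter (fun P => IsLeftDart K (finalDart P)), hexCriticalFugacity ^ mwLen P

/-- **Right exits of `T_{K,I}`** (through the right side `slev = I ∣ I+1`); the prefix of a triangle
walk up to a renewal crossing is one of these. [cite: KrachunPanagiotis2026, proof of Lemma 3.1 (R_{k,i}, Δ_{k,i})] -/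
def triDr₂ (K I : ℕ) : ℝ :=
  ∑ P ∈ (midWalks (triV₂ K I)).filter (fun P => IsRightDart I (finalDart P)), hexCriticalFugacity ^ mwLen P

/-! ### The clipped triangle (KP's trapezoid in the frame of the attached triangle) -/

/-- **The clipped triangle** `C(i,h) = T_i ∩ {x₀ ≤ h}`: the trapezoid `Trap_{2i+1,x} = Tria_{2i+1,x} ∩ 𝕌`
of Krachun–Panagiotis seen in the own frame of the attached triangle `Tria_{2i+1,x}` (root at the
attachment mid-edge `x` of height `h`): the real axis becomes the oblique cut `x₀ = h ∣ h+1`.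
[cite: KrachunPanagiotis2026, §3.2 (Trap_{2i+1,x})] -/
def clipV (i h : ℕ) : Finset HV := (triV i).filter fun v => v.1 ≤ h

/-- Membership in the clipped triangle. [cite: KrachunPanagiotis2026, §3.2] -/
theorem mem_clipV_iff {i h : ℕ} {v : HV} :
    v ∈ clipV i h ↔ 0 ≤ v.2.1 ∧ -(i : ℤ) ≤ v.1 ∧ v.1 + v.2.1 + bit v ≤ i ∧ v.1 ≤ h := by
  rw [clipV, mem_filter, mem_triV_iff]
  tauto

/-- `C(i,h) ⊆ T_i`. [cite: KrachunPanagiotis2026, §3.2] -/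
theorem clipV_subset (i h : ℕ) : clipV i h ⊆ triV i := filter_subset _ _

/-- **The cut class**: the final half-edge crosses the cut `x₀ = h ∣ h+1` of the clipped triangle, from
`(h, x₁, true)` to `(h+1, x₁, false)` (the shape of Duminil-Copin–Smirnov's right `ε̄`-cut half-edges,
`HV.IsEpsDart`, second case); in the lattice frame these are the exits of `Trap_{2i+1,x}` through the real
axis (KP's bottom side `B`). [cite: KrachunPanagiotis2026, §3.2 (F^B)] -/
def IsClipDart (h : ℕ) (d : HV × HV) : Prop :=
  d.1.1 = h ∧ d.1.2.2 = true ∧ d.2 = (d.1.1 + 1, d.1.2.1, false)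

/-- Decidability of the cut class. [folklore] -/
instance (h : ℕ) : DecidablePred (IsClipDart h) := fun d => by unfold IsClipDart; infer_instance

/-- KP's `F^L`: walks of the clipped triangle from the root back to the base line (class `α`;
winding `±π`, weight `cos(3π/8)`). [cite: KrachunPanagiotis2026, proof of Lemma 3.2 (F^L)] -/
def clipA (i h : ℕ) : ℝ :=
  ∑ P ∈ (midWalks (clipV i h)).filter (fun P => IsAlphaDart (finalDart P)), hexCriticalFugacity ^ mwLen P

/-- KP's `F^T`: walks of the clipped triangle to the left side of `T_i` (winding `+π/3`, weight `cos(π/8)`).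
[cite: KrachunPanagiotis2026, proof of Lemma 3.2 (F^T)] -/
def clipDl (i h : ℕ) : ℝ :=
  ∑ P ∈ (midWalks (clipV i h)).filter (fun P => IsLeftDart i (finalDart P)), hexCriticalFugacity ^ mwLen P

/-- KP's `F^R`: walks of the clipped triangle to the (clipped) right side of `T_i` (winding `-π/3`,
weight `cos(π/8)`). [cite: KrachunPanagiotis2026, proof of Lemma 3.2–3.3 (F^R)] -/
def clipDr (i h : ℕ) : ℝ :=
  ∑ P ∈ (midWalks (clipV i h)).filter (fun P => IsRightDart i (finalDart P)), hexCriticalFugacity ^ mwLen P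

/-- KP's `F^B`: walks of the clipped triangle leaving through the cut (winding `-2π/3`, weight `cos(π/4)`);
in the lattice frame, the walks of the trapezoid from `x` to the real axis — the second piece of
construction (a). [cite: KrachunPanagiotis2026, proof of Lemma 3.2 (F^B)] -/
def clipE (i h : ℕ) : ℝ :=
  ∑ P ∈ (midWalks (clipV i h)).filter (fun P => IsClipDart h (finalDart P)), hexCriticalFugacity ^ mwLen P

/-- **KP's `D⁻_{2i+1,x}`**: the walks of `T_i` from the root to its right side which VISIT a cell beyond
the cut (`x₀ ≥ h+1`), i.e. which are not walks of the clipped triangle ("start at `x`, end on the right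
side of Tria_{2i+1,x} and intersect the real axis"). [cite: KrachunPanagiotis2026, §3.2 (D⁻_{2i+1,x})] -/
def triDminus (i h : ℕ) : ℝ :=
  ∑ P ∈ (midWalks (triV i)).filter
      (fun P => IsRightDart i (finalDart P) ∧ ∃ v ∈ inner P, (h : ℤ) + 1 ≤ v.1),
    hexCriticalFugacity ^ mwLen P

/-! ### Crossings, renewal times, the renewal bound -/

/-- **The number of crossings of the line `slev = i ∣ i+1`** by a vertex list: the number of
consecutive pairs with slanted levels `{i, i+1}` (in either order). [cite: KrachunPanagiotis2026, §3.1] -/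
def crossCount (i : ℤ) (P : List HV) : ℕ :=
  ((P.zip P.tail).filter fun e =>
    (slev e.1 = i ∧ slev e.2 = i + 1) ∨ (slev e.1 = i + 1 ∧ slev e.2 = i)).length

/-- **The number of renewal times** `N(γ)` of a walk of `T_k`: the number of `i ∈ [0, k]` such that the
walk list crosses the line `slev = i ∣ i+1` exactly once ("`i` is a renewal time for `γ ∈ D(Tria_{2k+1})`
if `γ` intersects the line `i + 1/2 + e^{2πi/3}ℝ` exactly once … `k` is a renewal time whenever the walk
ends on the right side"). [cite: KrachunPanagiotis2026, §3.1 (N(γ))] -/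
def renewals (k : ℕ) (P : List HV) : ℕ := ((range (k + 1)).filter fun i : ℕ => crossCount (i : ℤ) P = 1).card

/-- **The walks of `T_k` from `a` to its right side** (their `x_c`-mass is `triDr k = triDl k`, half of
KP's `D_{2k+1}`). [cite: KrachunPanagiotis2026, Definition 2.3 (D(Tria_{2k+1}), R_{2k+1})] -/
def rightWalks (k : ℕ) : Finset (List HV) := (midWalks (triV k)).filter fun P => IsRightDart k (finalDart P)

/-- `triDr k` is the sum over `rightWalks k`. [cite: KrachunPanagiotis2026, Definition 2.3] -/
theorem triDr_eq_sum_rightWalks (k : ℕ) :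
    triDr k = ∑ P ∈ rightWalks k, hexCriticalFugacity ^ mwLen P := rfl

/-- **The exit height** of a walk: the `x₁`-coordinate of the inner endpoint of its final half-edge (for a
right exit of `T_k` at the cell `(x₀, x₁)`, `x₀ + x₁ = k`, this is KP's position `x ∈ R_{2k+1}`).
[cite: KrachunPanagiotis2026, §3.2 (x ∈ R_{2k+1})] -/
def htOf (P : List HV) : ℕ := ((finalDart P).1.2.1).toNat

/-- **The renewal bound** `Σ_{i=0}^{k} D_{2i+1} · B_{k-i}` of [KP, Lemma 3.1] in the tree's vocabulary:
`D_{2i+1} = 2·triDl i` and the bridge bound `B_m ≤ cos(π/8) D_m = 2cos(π/8)·triDl ⌊(m-1)/2⌋`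
(`HV.stripB_le_triDl`; for `m = 0`, `B_0 = 1 = 2cos(π/8)·triDl 0`).  It dominates `Σ_γ x_c^{ℓ(γ)} N(γ)`
over the right walks of `T_k`. [cite: KrachunPanagiotis2026, Lemma 3.1] -/
def renBound (k : ℕ) : ℝ :=
  ∑ i ∈ range (k + 1), 2 * triDl i * (2 * Real.cos (Real.pi / 8) * triDl ((k - i - 1) / 2))

/-- **KP's renewal cap `M_k`** (up to the harmless normalisation by `triDr k` instead of `D_{2k+1}`):
`8 · renBound k / triDr k`; by Markov, the right walks of `T_k` with more than `M_k` renewal times weigh at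
most `triDr k / 8`. [cite: KrachunPanagiotis2026, §3.2 (M_k)] -/
def renCap (k : ℕ) : ℝ := 8 * renBound k / triDr k

/-! ### Placements -/

/-- **The attachment automorphism** at the right dart of the cell `(x₀, x₁)`: `shift (x₀, x₁+1) ∘ rot60⁻¹`,
in coordinates `(y₀, y₁, b) ↦ (x₀ + y₀ + y₁ + b, x₁ - y₀, ¬b)`.  It sends the standard root dart `(w, O)`
to `((x₀,x₁,false), (x₀,x₁,true))`, the standard level `y₁` to the slanted level `slev - (x₀+x₁+1)` and the
standard coordinate `y₀` to the height `x₁ - ·`: the image of `T_i` is Krachun–Panagiotis's attached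
triangle `Tria_{2i+1,x} = x + e^{-πi/3} Tria_{2i+1}`, and the image of the clipped triangle `C(i, x₁)` is
its trapezoid `Trap_{2i+1,x}`. [cite: KrachunPanagiotis2026, §3.2 (Tria_{2i+1,x} := x + e^{-πi/3}Tria_{2i+1})] -/
def attach (x₀ x₁ : ℤ) : hvGraph ≃g hvGraph := rot60.symm.trans (shift x₀ (x₁ + 1))

/-- `attach` in coordinates. [cite: KrachunPanagiotis2026, §3.2] -/
@[simp] theorem attach_apply (x₀ x₁ : ℤ) (v : HV) :
    attach x₀ x₁ v = (x₀ + v.1 + v.2.1 + bit v, x₁ - v.1, !v.2.2) := by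
  obtain ⟨a, b, c⟩ := v
  show shift x₀ (x₁ + 1) (rot60.symm (a, b, c)) = _
  have e : rot60.symm (a, b, c) = (a + b + bit (a, b, c), -a - 1, !c) := rfl
  rw [e, shift_apply]
  refine Prod.ext ?_ (Prod.ext ?_ rfl) <;> dsimp only <;> omega

/-- `attach` sends `w` to the inner cell of the dart. [cite: KrachunPanagiotis2026, §3.2] -/
@[simp] theorem attach_wOut (x₀ x₁ : ℤ) : attach x₀ x₁ wOut = (x₀, x₁, false) := by
  rw [attach_apply]; simp [wOut]

/-- `attach` sends `O` to the outer cell of the dart. [cite: KrachunPanagiotis2026, §3.2] -/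
@[simp] theorem attach_hvOrigin (x₀ x₁ : ℤ) : attach x₀ x₁ hvOrigin = (x₀, x₁, true) := by
  rw [attach_apply]; simp [hvOrigin]

/-- The slanted level of an attached cell is `x₀ + x₁ + 1 +` its standard level `y₁`.
[cite: KrachunPanagiotis2026, §3.2] -/
theorem slev_attach (x₀ x₁ : ℤ) (v : HV) : slev (attach x₀ x₁ v) = x₀ + x₁ + 1 + v.2.1 := by
  obtain ⟨a, b, c⟩ := v
  rw [attach_apply, slev]
  cases c <;> simp [bit] <;> omega

/-- The height of an attached cell is `x₁ -` its standard coordinate `y₀`. [cite: KrachunPanagiotis2026, §3.2] -/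
theorem attach_snd_fst (x₀ x₁ : ℤ) (v : HV) : (attach x₀ x₁ v).2.1 = x₁ - v.1 := by
  rw [attach_apply]

/-! ### The dichotomy of [KP, §3.2] and KP's sequence `D_n` -/

/-- **A good exit height** (KP's `x ∈ Σ_{2k+1}`, eq. (4)): some `i ∈ [4T, 5T)` has
`D⁻_{2i+1,x} ≥ D_{2i+1}/4`, i.e. `triDminus i h ≥ triDl i / 2`.  (It depends on the exit only through its
height `h`.) [cite: KrachunPanagiotis2026, §3.2 (eq. (4), Σ_{2k+1})] -/
def GoodHt (T : ℕ) (h : ℕ) : Prop := ∃ i : ℕ, 4 * T ≤ i ∧ i < 5 * T ∧ triDl i / 2 ≤ triDminus i h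

/-- **A chosen good scale `i_x`** for a good height (and `0` otherwise). [cite: KrachunPanagiotis2026, §3.2 ("let us fix an integer 4T ≤ i_x ≤ 5T-1")] -/
def goodIdx (T : ℕ) (h : ℕ) : ℕ := by
  classical
  exact if H : GoodHt T h then Nat.find H else 0

/-- The chosen scale of a good height is good. [cite: KrachunPanagiotis2026, §3.2] -/
theorem goodIdx_spec {T h : ℕ} (H : GoodHt T h) :
    4 * T ≤ goodIdx T h ∧ goodIdx T h < 5 * T ∧ triDl (goodIdx T h) / 2 ≤ triDminus (goodIdx T h) h := by
  classical
  rw [goodIdx, dif_pos H]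
  exact Nat.find_spec H

/-- **KP's sequence `D_n`**: `D_{2k+1}` is the `x_c`-mass of the walks of Tria_{2k+1} `= T_k` to either far
side (`= triDl k + triDr k = 2·triDl k`), extended by `D_{2k+2} := D_{2k+1}` and `D_0 := 1/cos(π/8)`
(`= 2 x_c = 2·triDl 0`): uniformly `D_n = 2·triDl ⌊(n-1)/2⌋` with truncated subtraction.
[cite: KrachunPanagiotis2026, Definition 2.3 (D_{2k+1}, D_{2k+2}, D_0)] -/
def Dkp (n : ℕ) : ℝ := 2 * triDl ((n - 1) / 2)

/-- `D_{2k+1} = 2·triDl k`. [cite: KrachunPanagiotis2026, Definition 2.3] -/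
theorem Dkp_two_mul_add_one (k : ℕ) : Dkp (2 * k + 1) = 2 * triDl k := by
  rw [Dkp]; congr 2; omega

/-- `D_{2k+2} = D_{2k+1}`. [cite: KrachunPanagiotis2026, Definition 2.3] -/
theorem Dkp_two_mul_add_two (k : ℕ) : Dkp (2 * k + 2) = Dkp (2 * k + 1) := by
  rw [Dkp, Dkp]; congr 2; omega

/-- **KP's half-plane boundary two-point function `G_k`** (Definition 2.4: the `x_c`-mass of the U-walks
`0 → (k, 0)` of the upper half-plane), as the supremum over the Duminil-Copin–Smirnov trapezoids
`S_{N+1,N+1}` of the coded floor-arch mass at offset `d` (non-decreasing in `N`, bounded by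
`A_{N+1,N+1} ≤ 1/cos(3π/8)`). [cite: KrachunPanagiotis2026, Definition 2.4 (G_k)] -/
def halfPlaneArch (d : ℤ) : ℝ :=
  ⨆ N : ℕ, ∑ P ∈ (midWalks (stripV (N + 1) (N + 1))).filter
      (fun P => finalDart P = ((d, 0, false), (d, -1, true)) ∨ finalDart P = ((d, -1, true), (d, 0, false))),
    hexCriticalFugacity ^ mwLen P

/-- **Registered sub-goal `stub_kpDefs_frames`** (crux item stmt-CriticalPhenomena-0808, line
`root-locality-replaces-loewner`): the two frame facts every file of the Krachun–Panagiotis construction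
uses — the centred triangle `T_I` sits inside the off-centred `T_{K,I}` for `I ≤ K`, and the attachment
automorphism places the standard root dart `(w, O)` onto the right dart of the cell `(x₀, x₁)`.
[cite: KrachunPanagiotis2026, §3.1–3.2] -/
theorem stub_kpDefs_frames : (∀ (K I : ℕ), I ≤ K → Literature.Probability.RandomPlanarGeometry.SAW.HV.triV I ⊆ triV₂ K I) ∧ (∀ (x₀ x₁ : ℤ), attach x₀ x₁ Literature.Probability.RandomPlanarGeometry.SAW.HV.wOut = (x₀, x₁, false) ∧ attach x₀ x₁ Literature.Probability.RandomPlanarGeometry.SAW.hvOrigin = (x₀, x₁, true)) :=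
  ⟨fun _ _ h => triV_subset_triV₂ h, fun x₀ x₁ => ⟨attach_wOut x₀ x₁, attach_hvOrigin x₀ x₁⟩⟩

end Summit.CriticalPhenomena.SAWScalingLimit.Theorems.HexConjecture.RootLocality

end
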